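import Summits.HubbardSuperconductivity.HubbardSuperconductivity.Theorems.AnisotropyChordTransferFibre3RowCFactor

/-!
# Route `AnisotropyChord` / H0 rotor rung, row C (KT-2b): SOUNDNESS of the η-factorised sharp cell program
★★★ `RowC.offPoleTail_of_rowCCheckF`

Companion of `…RowCFactor` (program `rowCEF`/`rowCCellCheckF` + the master identity `rowCSE = η²·rowCEF`): the core `rowC_coreF`
(p2's cell chain on the unchanged extended box; the factorised inequality implies the sharp one after multiplying by `η² ≥ 0`) and
★★★ `offPoleTail_of_rowCCheckF`: a passing η-factorised sharp check + the column certificate + the X-sum certificate give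
`‖R′‖² − P − lowN ≤ bC·η_eff·(2ε₁ − T⁺)·U` for EVERY `L ≥ 128` and every ground profile in the cell (window cancellation built in).
Prover seat `hubbard-h0-rotor-p1` g29 (route lead); helper for piece A = stmt-HubbardSuperconductivity-23918 of rung 19089
(`--supports`, helper class).  Nothing here proves superconductivity in the Hubbard model; soundness of ONE kernel program of ONE row
of ONE conditional reduction; the rotor TARGET as originally worded stays FALSE (g15 verdict).  Tree imports only; no sorry.
-/

set_option linter.dupNamespace false
set_option autoImplicit false

open Literature.Analysis.ValidatedNumerics

namespace Summit.HubbardSuperconductivity.HubbardSuperconductivity.Theorems.AnisotropyChord.Transfer.Fibre3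

namespace RowC

open L2.N1

variable (L : ℕ) [NeZero L]

/-! ## Soundness -/

/-- ★ CORE: a passing row-C check gives, at the ground profile, `P̂ > 0` and the evaluated row inequality
`9(√ChiN + √NhiN)² ≤ 48π⁴·bC·π²ν·(2ê₁ − τ)·τ`, `τ = 3ν − (3/2)Q̂₁/P̂`. [folklore] -/
theorem rowC_coreF (c : L2.NamedCell) (a1 a2 xshi bC : ℚ) (pi : ℕ × ℕ)
    (hchk : rowCCellCheckF c a1 a2 xshi bC pi = true) (hc : c.check = true) (hL : 128 ≤ L)
    {Δ lam2 : ℝ} {f : Tor L → ℝ} (hΔ0 : 0 ≤ Δ) (hΔ1 : Δ < 1) (hf : IsGroundTwoMagnon L Δ lam2 f)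
    (hν1 : (c.n1 : ℝ) / c.νd ≤ lam2 / (2 * Real.pi / L) ^ 2) (hν2 : lam2 / (2 * Real.pi / L) ^ 2 ≤ (c.n2 : ℝ) / c.νd)
    (ha1 : ((a1 : ℚ) : ℝ) ≤ Δ * f (K1 L)) (ha2 : Δ * f (K1 L) ≤ ((a2 : ℚ) : ℝ)) :
    let t : ℝ := (2 * Real.pi / L) ^ 2
    let vP : ℝ := t ^ 3 * ∑ k : Tor L, F2 L f k ^ 3
    let vQ : ℝ := t ^ 2 * ∑ k : Tor L, nK L f k * F2 L f k
    0 < vP ∧ t ^ 2 * S2n L lam2 ≤ ((c.bS2.2 : ℚ) : ℝ) ∧ t ^ 2 * T10n L lam2 ≤ ((c.bT10.2 : ℚ) : ℝ) ∧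
    9 * (Real.sqrt (ChiN t (lam2 / t) (Δ * f (K1 L)) (eps1 L / t) (t ^ 2 * S2n L lam2) xshi)
        + Real.sqrt (NhiN t (lam2 / t) (Δ * f (K1 L)) (t ^ 2 * S2n L lam2) (aKer L lam2 (ex L + ey L))
            (aKer L lam2 (ex L + ex L)) (N41E.ZwSN t (lam2 / t) (Δ * f (K1 L))))) ^ 2
      - 48 * (Real.pi ^ 2) ^ 2 * bC * (Real.pi ^ 2 * (lam2 / t)) * (2 * (eps1 L / t) - (3 * (lam2 / t) - 3 / 2 * vQ * vP⁻¹))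
          * (3 * (lam2 / t) - 3 / 2 * vQ * vP⁻¹) ≤ 0 := by
  classical
  intro t vP vQ
  set X := xTrue L Δ lam2 f (Δ * f (K1 L)) with hXdef
  have hLpos : (0 : ℝ) < L := by exact_mod_cast (show 0 < L by omega)
  have hπ := Real.pi_pos
  have ht0 : 0 < t := by positivity
  -- regime facts (as in `trialGap_of_cellCheck`)
  have hlam : 0 < lam2 := lam2_pos L (by omega) hΔ1 hf.1
  have h2 : 2 * lam2 < eps1 L := two_lam2_lt_eps1 L (by omega) hΔ0 hf
  obtain ⟨ha0, haV, _, _⟩ := ManifoldA.manifold_band L hL hΔ0 hΔ1 hf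
  have hνc := ManifoldA.nu_ceiling L hL hΔ0 hf
  have hν4 : lam2 / (2 * Real.pi / L) ^ 2 < 4 / Real.pi ^ 2 := by
    rw [div_lt_iff₀ ht0]
    have hπ2 : Real.pi ^ 2 < 10 := by nlinarith [Real.pi_lt_d2, Real.pi_pos]
    have : (0.031 : ℝ) ≤ 4 / Real.pi ^ 2 := by rw [le_div_iff₀ (by positivity)]; nlinarith
    nlinarith
  have hV1 : (1 : ℝ) / (L : ℝ) ^ 2 = t * (4 * Real.pi ^ 2)⁻¹ := by
    show (1 : ℝ) / (L : ℝ) ^ 2 = (2 * Real.pi / L) ^ 2 * (4 * Real.pi ^ 2)⁻¹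
    field_simp; ring
  have hu' : 0 < 1 - Δ * f (K1 L) + Δ * f (K1 L) * ((2 * Real.pi / L) ^ 2 * (4 * Real.pi ^ 2)⁻¹) := by
    have : (2 * Real.pi / (L : ℝ)) ^ 2 * (4 * Real.pi ^ 2)⁻¹ = 1 / (L : ℝ) ^ 2 := hV1.symm
    rw [this]; nlinarith
  obtain ⟨_, _, _, _, d5, _, _⟩ := ManifoldA.manifold_dictionary L (by omega) hΔ0 hΔ1 hf
  have hu : 0 < cS L Δ lam2 f * Gzero L lam2 := by
    rw [← Gres_zero_zero_eq_Gzero, d5]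
    have : Δ * f (K1 L) / (L : ℝ) ^ 2 = Δ * f (K1 L) * ((2 * Real.pi / L) ^ 2 * (4 * Real.pi ^ 2)⁻¹) := by
      rw [← hV1]; ring
    rw [this]; exact hu'
  -- the interval layer of p2
  have hPM : PMem (c.box a1 a2) X := pmem_xTrue c hc a1 a2 L hL Δ lam2 f _ hν1 hν2 ha1 ha2
  have hsp := xTrue_specs_ground L Δ lam2 f (by omega) hΔ0 hΔ1 hf hlam h2 hν4 ha0 hu'
  set vB : ℝ := ((2 * Real.pi / L) ^ 2) ^ 3 * ∑ k : Tor L, F2 L f k ^ 2 * F2 L f (k + K1 L) with hvB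
  set vA : ℝ := ((2 * Real.pi / L) ^ 2) ^ 2 * ∑ k : Tor L, F2 L f k ^ 2 * cosx L k with hvA
  set vJ : ℝ := ((2 * Real.pi / L) ^ 2) ^ 2 * ∑ k : Tor L, bcJ L f k with hvJ
  have oB := bHat_mem L Δ lam2 f (by omega) hΔ0 hΔ1 hf hlam h2 hu
  have oP := pHat_mem L Δ lam2 f (by omega) hΔ0 hΔ1 hf hlam h2 hu
  have oA := aHat_mem L Δ lam2 f (by omega) hΔ0 hΔ1 hf hlam h2 hu
  have oQ := q1Hat_mem L Δ lam2 f (by omega) hΔ0 hΔ1 hf hlam h2 hu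
  have oJ := j1Hat_mem L Δ lam2 f (by omega) hΔ0 hΔ1 hf hlam h2 hu
  have hob : ∀ j (hj : j < (objSpecsC 2).length) (hj' : j < [vB, vP, vA, vQ, vJ].length),
      ((objSpecsC 2)[j].1).eval X ≤ [vB, vP, vA, vQ, vJ][j] ∧ [vB, vP, vA, vQ, vJ][j] ≤ ((objSpecsC 2)[j].2).eval X := by
    intro j hj hj'
    have hj5 : j < 5 := by simpa [objSpecsC] using hj
    interval_cases j
    · simpa [objSpecsC] using oB
    · simpa [objSpecsC] using oP
    · simpa [objSpecsC] using oA
    · simpa [objSpecsC] using oQ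
    · simpa [objSpecsC] using oJ
  -- unpack the row-C check
  have hlen0 : (c.box a1 a2).length = 16 := by simp [L2.NamedCell.box]
  have hv := specsVarsOkC_two
  simp only [specsVarsOkC, Bool.and_eq_true] at hv
  obtain ⟨hv1, hv2⟩ := hv
  have hS : SpecsHold X (c.box a1 a2).length (specs 2) := by
    rw [hlen0]; exact specsHold_of X (specs 2) 16 hv1 hsp
  unfold rowCCellCheckF cellFinalBoxC cellBox at hchk
  split at hchk
  · exact absurd hchk (by simp)
  · rename_i F hF
    split at hF
    · exact absurd hF (by simp)
    · rename_i B hB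
      split at hF
      · exact absurd hF (by simp)
      · rename_i objs hobjs
        simp only [Option.some.injEq] at hF
        subst hF
        obtain ⟨hPB, hlenB⟩ := extendBox_sound pi.1 pi.2 X (specs 2) _ B hB hPM hS
        have hO : ObjsHold X B.length (objSpecsC 2) [vB, vP, vA, vQ, vJ] := by
          rw [hlenB, hlen0]
          exact objsHold_of X _ (objSpecsC 2) [vB, vP, vA, vQ, vJ] (by simp [objSpecsC]) hv2 hob
        have hbr := encloseObjs_sound pi.1 pi.2 hPB (objSpecsC 2) [vB, vP, vA, vQ, vJ] objs hobjs hO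
        have hmem := finalBox_mem hPB (by
          rw [hlenB, hlen0]
          simp only [specs, List.length_append, List.length_cons, List.length_nil, List.length_map]
          omega) hbr
        simp only [Bool.and_eq_true, decide_eq_true_eq] at hchk
        obtain ⟨⟨⟨⟨hFlen, hR⟩, hP⟩, _⟩, _⟩ := hchk
        obtain ⟨y0, y1, y2, y3, y4, y5, y6, y7, y8, y9⟩ := finalVec_vals X vB vP vA vQ vJ
        -- coordinates of `X`
        have hX0 : X 0 = t := xTrue_zero L Δ lam2 f _
        have hX1 : X 1 = Real.pi ^ 2 := by rw [hXdef, xTrue_lt16 L Δ lam2 f _ (by norm_num)]; rfl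
        have hX2 : X 2 = lam2 / t := by rw [hXdef, xTrue_lt16 L Δ lam2 f _ (by norm_num)]; rfl
        have hX3 : X 3 = Δ * f (K1 L) := by rw [hXdef, xTrue_lt16 L Δ lam2 f _ (by norm_num)]; rfl
        have hX4 : X 4 = t ^ 2 * S2n L lam2 := by
          rw [hXdef, xTrue_lt16 L Δ lam2 f _ (by norm_num)]
          show (2 * Real.pi / L) ^ (2 * 2) * S2n L lam2 = _
          ring
        have hX7 : X 7 = t ^ 2 * T10n L lam2 := by
          rw [hXdef, xTrue_lt16 L Δ lam2 f _ (by norm_num)]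
          show (2 * Real.pi / L) ^ (2 * 2) * T10n L lam2 = _
          ring
        have hX16 : X 16 = eps1 L / t := by rw [hXdef, xTrue_16]; rfl
        -- the brackets of `x₄`, `x₇` from the column box
        have hB4 := hPM 4 (by rw [hlen0]; norm_num)
        have hB7 := hPM 7 (by rw [hlen0]; norm_num)
        have e4 : (c.box a1 a2).ivl 4 = c.bS2 := by simp [L2.NamedCell.box, Box.ivl]
        have e7 : (c.box a1 a2).ivl 7 = c.bT10 := by simp [L2.NamedCell.box, Box.ivl]
        rw [e4, hX4] at hB4
        rw [e7, hX7] at hB7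
        -- the window values and the extended vector
        obtain ⟨h11, h20⟩ := window_k11_k20 L hL hΔ0 hΔ1 hf
        set y' := extVec (finalVec X [vB, vP, vA, vQ, vJ]) (t ^ 2 * S2n L lam2) (aKer L lam2 (ex L + ey L))
          (aKer L lam2 (ex L + ex L)) with hy'
        have hmem' : (rowCBox c (finalBox B objs)).mem y' := extVec_mem c hFlen hmem hB4 h11 h20
        have eF := rexprLeOn_sound hR _ hmem'
        -- the factorised inequality implies the sharp one (multiply by `η² ≥ 0`)
        have g1' : y' 1 = Real.pi ^ 2 := by simp [hy', extVec, y1, hX1]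
        have g2' : y' 2 = lam2 / t := by simp [hy', extVec, y2, hX2]
        have hν' : 0 < y' 2 := by rw [g2']; positivity
        have eF' : (rowCEF xshi bC).eval y' ≤ 0 := by simpa using eF
        have eR : (rowCSE xshi bC).eval y' ≤ ((0 : ℚ) : ℝ) := by
          rw [eval_rowCSE_eq_factor y' g1' hν' xshi bC]
          push_cast
          exact mul_nonpos_of_nonneg_of_nonpos (sq_nonneg _) eF'
        have eP1 := rexprLeOn_sound hP _ hmem'
        -- coordinates of `y'`
        have g0 : y' 0 = t := by simp [hy', extVec, y0, hX0]
        have g1 : y' 1 = Real.pi ^ 2 := by simp [hy', extVec, y1, hX1]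
        have g2 : y' 2 = lam2 / t := by simp [hy', extVec, y2, hX2]
        have g3 : y' 3 = Δ * f (K1 L) := by simp [hy', extVec, y3, hX3]
        have g4 : y' 4 = eps1 L / t := by simp [hy', extVec, y4, hX16]
        have g6 : y' 6 = vP := by simp [hy', extVec, y6]
        have g8 : y' 8 = vQ := by simp [hy', extVec, y8]
        have g10 : y' 10 = t ^ 2 * S2n L lam2 := by simp [hy', extVec]
        have g11 : y' 11 = aKer L lam2 (ex L + ey L) := by simp [hy', extVec]
        have g12 : y' 12 = aKer L lam2 (ex L + ex L) := by simp [hy', extVec]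
        rw [eval_rowCSE y' g1 xshi bC, g0, g2, g3, g4, g6, g8, g10, g11, g12] at eR
        simp only [yP, RExpr.eval] at eP1
        rw [g6] at eP1
        have e0 : (((0 : ℚ)) : ℝ) = 0 := by push_cast; ring
        have e1' : (((-1 : ℚ)) : ℝ) = -1 := by push_cast; ring
        rw [e0] at eR
        rw [e1'] at eP1
        exact ⟨by linarith, hB4.2, hB7.2, eR⟩

/-- ★★★ **A PASSING η-FACTORISED SHARP ROW-C CELL CHECK GIVES THE (KT-2b″) BOUND FOR EVERY `L ≥ 128` ON THE CELL** (window-shell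
cancellation built in; no window hypothesis). -/
theorem offPoleTail_of_rowCCheckF (c : L2.NamedCell) (a1 a2 xshi bC : ℚ) (pi : ℕ × ℕ) (Dxs : ℕ)
    (hchk : rowCCellCheckF c a1 a2 xshi bC pi = true) (hc : c.check = true)
    (hxs : xsCellCheck 128 c.n1 c.n2 c.νd c.Tn c.Td Dxs c.bS2.2 c.bT10.2 xshi = true)
    (hL : 128 ≤ L)
    {Δ lam2 : ℝ} {f : Tor L → ℝ} (hΔ0 : 0 ≤ Δ) (hΔ1 : Δ < 1) (hf : IsGroundTwoMagnon L Δ lam2 f)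
    (hν1 : (c.n1 : ℝ) / c.νd ≤ lam2 / (2 * Real.pi / L) ^ 2) (hν2 : lam2 / (2 * Real.pi / L) ^ 2 ≤ (c.n2 : ℝ) / c.νd)
    (ha1 : ((a1 : ℚ) : ℝ) ≤ Δ * f (K1 L)) (ha2 : Δ * f (K1 L) ≤ ((a2 : ℚ) : ℝ)) :
    (ip L (resid L Δ f) (resid L Δ f)).re - polePart L Δ f - lowNormPart L Δ f
      ≤ (bC : ℝ) * etaEff L lam2 * (2 * eps1 L - Tplus L Δ f) * Uunit L Δ f := by
  have hLpos : (0 : ℝ) < L := by exact_mod_cast (show 0 < L by omega)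
  have hπ := Real.pi_pos
  have hL2 : 2 ≤ L := by omega
  set t : ℝ := (2 * Real.pi / L) ^ 2 with ht
  have ht0 : 0 < t := by positivity
  obtain ⟨hvP0, hx4, hx7, eR⟩ := rowC_coreF L c a1 a2 xshi bC pi hchk hc hL hΔ0 hΔ1 hf hν1 hν2 ha1 ha2
  have hT := Tplus_eq_tau L hL2 hf hvP0
  rw [← ht] at hvP0 hx4 hx7 eR hT
  set vP : ℝ := t ^ 3 * ∑ k : Tor L, F2 L f k ^ 3 with hvP
  set vQ : ℝ := t ^ 2 * ∑ k : Tor L, nK L f k * F2 L f k with hvQ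
  -- the X-sum certificate
  have hlamθ : lam2 = lam2 / t * (2 * Real.pi / L) ^ 2 := by rw [ht]; field_simp
  have hXS : XSn L lam2 ≤ ((xshi : ℚ) : ℝ) := by
    have h := xs_cell_sound 128 c.n1 c.n2 c.νd c.Tn c.Td Dxs c.bS2.2 c.bT10.2 xshi hxs L hL (lam2 / t)
      (by rw [ht]; exact hν1) (by rw [ht]; exact hν2)
      (by rw [← hlamθ, ← ht]; exact hx4) (by rw [← hlamθ, ← ht]; exact hx7)
    rw [← hlamθ] at h; exact h
  -- the two closed-form majorants at the true profile
  have hChi := cs2_le_ChiN L hL hΔ0 hΔ1 hf ((xshi : ℚ) : ℝ) hXS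
  have hNhi := nC0p_le_NhiN L hL hΔ0 hΔ1 hf _ (shellWinSharpN_holds L hL Δ lam2 f hΔ0 hΔ1 hf)
  rw [← ht] at hChi hNhi
  -- the RHS identity
  obtain ⟨_, _, _, _, _, _, d7⟩ := ManifoldA.manifold_dictionary L (by omega) hΔ0 hΔ1 hf
  have hVθ : ((L : ℝ) ^ 2) = 4 * Real.pi ^ 2 / t := by rw [ht]; field_simp; ring
  have hRHS : (bC : ℝ) * etaEff L lam2 * (2 * eps1 L - Tplus L Δ f) * Uunit L Δ f
      = 48 * (Real.pi ^ 2) ^ 2 * bC * (Real.pi ^ 2 * (lam2 / t))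
          * (2 * (eps1 L / t) - (3 * (lam2 / t) - 3 / 2 * vQ * vP⁻¹)) * (3 * (lam2 / t) - 3 / 2 * vQ * vP⁻¹) := by
    unfold Uunit
    rw [d7, ← ht, hT, hVθ]
    field_simp
    ring
  -- the LHS chain
  have hmirror : ∀ r : Tor L, f (-r.1, r.2) = f r := ground_mirror L hL2 hf
  have hpieces := offPoleTailFromPieces_holds L hL2 Δ lam2 f hf hmirror
  have hP0 := polePartNonneg_holds L Δ f
  have hN0 := lowNormPartNonneg_holds L Δ f
  have hsq : (3 * Real.sqrt (cs2 L f) + 3 * Real.sqrt (nC0p L Δ f)) ^ 2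
      ≤ 9 * (Real.sqrt (ChiN t (lam2 / t) (Δ * f (K1 L)) (eps1 L / t) (t ^ 2 * S2n L lam2) xshi)
        + Real.sqrt (NhiN t (lam2 / t) (Δ * f (K1 L)) (t ^ 2 * S2n L lam2)
            (aKer L lam2 (ex L + ey L)) (aKer L lam2 (ex L + ex L)) (N41E.ZwSN t (lam2 / t) (Δ * f (K1 L))))) ^ 2 := by
    have s1 := Real.sqrt_le_sqrt hChi
    have s2 := Real.sqrt_le_sqrt hNhi
    have e : (3 * Real.sqrt (cs2 L f) + 3 * Real.sqrt (nC0p L Δ f)) ^ 2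
        = 9 * (Real.sqrt (cs2 L f) + Real.sqrt (nC0p L Δ f)) ^ 2 := by ring
    rw [e]
    apply mul_le_mul_of_nonneg_left _ (by norm_num)
    apply pow_le_pow_left₀ (by positivity)
    linarith
  rw [hRHS]
  linarith [hpieces, hP0, hN0, hsq, eR]

end RowC

end Summit.HubbardSuperconductivity.HubbardSuperconductivity.Theorems.AnisotropyChord.Transfer.Fibre3
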